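import Literature.Topology.FourManifolds.HCobordismCancelStep
import Literature.Topology.FourManifolds.RearrangementSlabProofs
import HarnessLib

/-!
# Raising one `1`-handle above the others (Milnor's Thm. 4.2 on the slab of the `1`-handles)

Topic `Literature/Topology/FourManifolds` (fact seat
`provefact-Literature.Topology.FourManifolds.lauden-f709dd520c`, Laudenbach–Poénaru's Lemma 2: the
slide of the `1`-handle of the critical point `q` over the other `1`-handles is performed with
a Morse function for which `q` is the *top* critical point, all other critical points lying
below a level `c₀ < g₁ q`; Milnor's rearrangement theorem provides it from the nice Morse
function, keeping the gradient-like field — hence the left-hand discs — unchanged).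
Everything here is **proved**; no named facts.

**Theorem** (`Cobordism.IsNiceMorseFunction.exists_oneHandle_on_top`).  Let `g` be a nice Morse
function on the cobordism `c` all of whose critical points have index `≤ 1`, `ξ` a smooth
gradient-like field, `q` a critical point of index `1`.  Then there are a Morse function `g₁`
on `c` with `ξ` still gradient-like, the same critical points and indices, and a level `c₀`
with `a₀ ≤ c₀ < g₁ q < plusLevel n 1`, for any prescribed `a₀ ∈ (niceLevel n 0, niceLevel n 1)`
(`exists_oneHandle_on_top_above`; `a₀ = plusLevel n 0` in `exists_oneHandle_on_top`), such that
every critical point other than `q` has `g₁ < c₀`; `g₁ = g` off `g⁻¹(a₀, plusLevel n 1)` (in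
particular below the level `a₀`, above the `0`-handle), `g₁` maps that open slab into itself, and
`g₁ = g + const` near `q`.  Proof: if `q` is the only critical point of index `1`, `g₁ = g`;
otherwise Thm. 4.2 on the slab `g⁻¹[plusLevel n 0, plusLevel n 1]` with `P = {q}` raised to
`(niceLevel n 1 + plusLevel n 1)/2` and `P'` the other index-`1` points kept at `niceLevel n 1`
— their trajectory sets are disjoint from that of `q` because they lie on the same level
(`IsGradientLike.disjoint_trajectorySet_of_apply_eq`).

## References

* J. Milnor, *Lectures on the h-cobordism theorem* (1965), Thms. 4.1, 4.2 (PDF pp. 22–23),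
  pattern of PDF p. 57. [MilnorHCobordism1965]
* F. Laudenbach, V. Poénaru, Bull. Soc. Math. France 100 (1972), proof of Lemma 2 (p. 340).
  [LaudenbachPoenaruBSMF1972]
-/

open scoped Manifold ContDiff Topology
open Set Function Filter

noncomputable section

namespace Literature.Topology.FourManifolds

universe u

variable {n : ℕ} {M N : Type u} [TopologicalSpace M] [T2Space M] [SecondCountableTopology M]
  [ChartedSpace (EuclideanSpace ℝ (Fin n)) M] [IsManifold (𝓡 n) ∞ M] [CompactSpace M]
  [TopologicalSpace N] [T2Space N] [SecondCountableTopology N] [ChartedSpace (EuclideanSpace ℝ (Fin n)) N]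
  [IsManifold (𝓡 n) ∞ N] [CompactSpace N]

/-- **One `1`-handle on top, above a prescribed level `a₀`** between the levels of the
`0`-handles and the `1`-handles (see the module docstring; the slab used is
`g⁻¹(a₀, plusLevel n 1)`). [cite: MilnorHCobordism1965, Thm. 4.2 (PDF p. 23) and its proof; pattern of PDF p. 57] -/
theorem Cobordism.IsNiceMorseFunction.exists_oneHandle_on_top_above (hn : 1 ≤ n) {c : Cobordism n M N} {g : c.W → ℝ}
    (hg : c.IsNiceMorseFunction g) {a₀ : ℝ} (ha₀ : niceLevel n 0 < a₀) (ha₁ : a₀ < niceLevel n 1)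
    (ξ : Cₛ^∞⟮𝓡∂ (n + 1); EuclideanSpace ℝ (Fin (n + 1)), (TangentSpace (𝓡∂ (n + 1)) : c.W → Type)⟯)
    (hξ : IsGradientLike (𝓡∂ (n + 1)) g ξ)
    (hidx : ∀ z ∈ criticalSet (𝓡∂ (n + 1)) g, morseIndex (𝓡∂ (n + 1)) g z ≤ 1)
    {q : c.W} (hq : q ∈ criticalSetOfIndex (𝓡∂ (n + 1)) g 1) :
    ∃ (g₁ : c.W → ℝ) (c₀ : ℝ), c.IsMorseFunction g₁ ∧ IsGradientLike (𝓡∂ (n + 1)) g₁ ξ ∧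
      criticalSet (𝓡∂ (n + 1)) g₁ = criticalSet (𝓡∂ (n + 1)) g ∧
      (∀ z ∈ criticalSet (𝓡∂ (n + 1)) g, morseIndex (𝓡∂ (n + 1)) g₁ z = morseIndex (𝓡∂ (n + 1)) g z) ∧
      a₀ ≤ c₀ ∧ c₀ < g₁ q ∧ g₁ q < plusLevel n 1 ∧
      (∀ z ∈ criticalSet (𝓡∂ (n + 1)) g, z ≠ q → g₁ z < c₀) ∧
      (∀ z, g z ∉ Ioo a₀ (plusLevel n 1) → g₁ z = g z) ∧
      (∀ z, g z ∈ Ioo a₀ (plusLevel n 1) → g₁ z ∈ Ioo a₀ (plusLevel n 1)) ∧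
      (∃ d : ℝ, ∀ᶠ z in 𝓝 q, g₁ z = g z + d) := by
  -- levels
  have hLP : ∀ k, niceLevel n k < plusLevel n k := niceLevel_lt_plusLevel n
  have hPL : ∀ k, plusLevel n k < niceLevel n (k + 1) := plusLevel_lt_niceLevel_succ n
  have hLmono : StrictMono (niceLevel n) := niceLevel_strictMono n
  have hL0 : 0 < niceLevel n 0 := niceLevel_pos n 0
  have h00 : niceLevel n 0 < a₀ := ha₀
  have h01 : a₀ < niceLevel n 1 := ha₁
  have h11 : niceLevel n 1 < plusLevel n 1 := hLP 1
  have hP0 : 0 < a₀ := hL0.trans h00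
  have hP1 : plusLevel n 1 < 1 := by
    rw [plusLevel_def, div_lt_one (by positivity)]
    push_cast
    have : (1 : ℝ) ≤ n := by exact_mod_cast hn
    linarith
  -- values of the critical points of the nice `g`
  have hv : ContMDiff (𝓡∂ (n + 1)) (𝓡∂ (n + 1)).tangent 1
      (fun y ↦ (⟨y, ξ y⟩ : TangentBundle (𝓡∂ (n + 1)) c.W)) :=
    ξ.contMDiff.of_le (WithTop.coe_le_coe.mpr le_top)
  have hval : ∀ z ∈ criticalSet (𝓡∂ (n + 1)) g, g z = niceLevel n (morseIndex (𝓡∂ (n + 1)) g z) :=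
    fun z hz => hg.2 z hz
  have hqc : q ∈ criticalSet (𝓡∂ (n + 1)) g := hq.1
  have hqval : g q = niceLevel n 1 := by rw [hval q hqc, hq.2]
  -- a critical point other than the index-`1` points has index `0`, value `niceLevel n 0`
  have hval0 : ∀ z ∈ criticalSet (𝓡∂ (n + 1)) g, z ∉ criticalSetOfIndex (𝓡∂ (n + 1)) g 1 →
      g z = niceLevel n 0 := by
    intro z hz hz1
    have hi := hidx z hz
    have hne : morseIndex (𝓡∂ (n + 1)) g z ≠ 1 := fun h => hz1 ⟨hz, h⟩
    have h0 : morseIndex (𝓡∂ (n + 1)) g z = 0 := by omega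
    rw [hval z hz, h0]
  -- the other critical points of index `1`
  set P' : Set c.W := criticalSetOfIndex (𝓡∂ (n + 1)) g 1 \ {q} with hP'
  by_cases hne : P'.Nonempty
  · -- 4.2 with `P = {q}` raised to `aP` and `P'` kept at `L₁`
    set aP : ℝ := (niceLevel n 1 + plusLevel n 1) / 2 with haP
    have haP1 : niceLevel n 1 < aP := by rw [haP]; linarith
    have haP2 : aP < plusLevel n 1 := by rw [haP]; linarith
    -- the critical points of `g` in the closed slab `[V₀₊, V₁₊]` are `q` and `P'`
    have hslab : ∀ z ∈ criticalSet (𝓡∂ (n + 1)) g,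
        g z ∈ Icc (a₀) (plusLevel n 1) → z ∈ ({q} ∪ P' : Set c.W) := by
      intro z hz hzI
      have hj : morseIndex (𝓡∂ (n + 1)) g z = 1 := by
        by_contra hj
        have h0 := hval0 z hz (fun h => hj h.2)
        rw [h0] at hzI
        linarith [hzI.1]
      by_cases hzq : z = q
      · exact Or.inl hzq
      · exact Or.inr ⟨⟨hz, hj⟩, hzq⟩
    have hPsub : ({q} ∪ P' : Set c.W) ⊆ criticalSet (𝓡∂ (n + 1)) g := by
      rintro z (hz | hz)
      · rw [mem_singleton_iff.1 hz]; exact hqc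
      · exact hz.1.1
    have hdisjP : Disjoint ({q} : Set c.W) P' := disjoint_singleton_left.2 fun h => h.2 rfl
    have hvalP' : ∀ z ∈ P', g z = niceLevel n 1 := fun z hz => by rw [hval z hz.1.1, hz.1.2]
    have hK : Disjoint (⋃ z ∈ ({q} : Set c.W), trajectorySet (𝓡∂ (n + 1)) ξ z)
        (⋃ z ∈ P', trajectorySet (𝓡∂ (n + 1)) ξ z) := by
      refine disjoint_iUnion₂_left.2 fun z hz => disjoint_iUnion₂_right.2 fun z' hz' => ?_
      rw [mem_singleton_iff] at hz
      rw [hz]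
      exact hξ.disjoint_trajectorySet_of_apply_eq hv
        (hg.1.isMorse.contMDiff.mdifferentiable (by simp)) (fun h => hz'.2 h.symm)
        (hqval.trans (hvalP' z' hz').symm)
    obtain ⟨g₁, hg₁, hξ₁, hcrit₁, hvP, hvP', hnear, hIoo, hlocP, hlocP'⟩ :=
      Cobordism.Milnor1965_rearrangement_slab_holds hg.1 ξ hξ hP0 (h01.trans h11) hP1
        (singleton_nonempty q) hne hdisjP hPsub hslab
        (show niceLevel n 1 ∈ Ioo (a₀) (plusLevel n 1) from ⟨h01, h11⟩)
        (show niceLevel n 1 ∈ Ioo (a₀) (plusLevel n 1) from ⟨h01, h11⟩)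
        (fun z hz => by rw [mem_singleton_iff.1 hz, hqval]) hvalP' hK
        ⟨h01.trans haP1, haP2⟩ ⟨h01, h11⟩
    have hout : ∀ z, g z ∉ Ioo (a₀) (plusLevel n 1) → g₁ z = g z := fun z hz =>
      hnear.self_of_nhdsSet z hz
    have hnear' : ∀ z, g z ∉ Ioo (a₀) (plusLevel n 1) → g₁ =ᶠ[𝓝 z] g :=
      fun z hz => hnear.filter_mono (nhds_le_nhdsSet hz)
    refine ⟨g₁, (niceLevel n 1 + aP) / 2, hg₁, hξ₁, hcrit₁, ?_, by linarith, ?_, ?_, ?_, hout, hIoo, ⟨aP - niceLevel n 1, hlocP q rfl⟩⟩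
    · -- indices
      intro z hz
      by_cases hzs : g z ∈ Icc (a₀) (plusLevel n 1)
      · rcases hslab z hz hzs with hzq | hzP'
        · rw [mem_singleton_iff] at hzq
          subst hzq
          exact morseIndex_congr_of_eventuallyEq_add_const (hlocP z rfl)
        · exact morseIndex_congr_of_eventuallyEq_add_const (hlocP' z hzP')
      · exact morseIndex_congr_of_eventuallyEq (hnear' z fun h => hzs (Ioo_subset_Icc_self h))
    · rw [hvP q rfl]; linarith
    · rw [hvP q rfl]; exact haP2
    · -- the other critical points lie below `c₀`
      intro z hz hzq
      by_cases hzs : g z ∈ Icc (a₀) (plusLevel n 1)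
      · rcases hslab z hz hzs with hzq' | hzP'
        · exact absurd (mem_singleton_iff.1 hzq') hzq
        · rw [hvP' z hzP']; linarith
      · have hzo : g z ∉ Ioo (a₀) (plusLevel n 1) := fun h => hzs (Ioo_subset_Icc_self h)
        rw [hout z hzo]
        -- `z` is of index `0`
        have hz1 : z ∉ criticalSetOfIndex (𝓡∂ (n + 1)) g 1 := fun h => hzs (by rw [hval z hz, h.2]; exact ⟨h01.le, h11.le⟩)
        rw [hval0 z hz hz1]; linarith
  · -- `q` is the only critical point of index `1`: keep `g`
    have hP'e : P' = ∅ := not_nonempty_iff_eq_empty.1 hne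
    refine ⟨g, a₀, hg.1, hξ, rfl, fun z _ => rfl, le_rfl, by rw [hqval]; exact h01, by rw [hqval]; exact h11,
      ?_, fun z _ => rfl, fun z hz => hz, ⟨0, Filter.Eventually.of_forall fun z => (add_zero _).symm⟩⟩
    intro z hz hzq
    have hz1 : z ∉ criticalSetOfIndex (𝓡∂ (n + 1)) g 1 := fun h => by
      have : z ∈ P' := ⟨h, hzq⟩
      rw [hP'e] at this; exact this
    rw [hval0 z hz hz1]; exact h00

/-- **One `1`-handle on top** (see the module docstring): the case `a₀ = plusLevel n 0`.
[cite: MilnorHCobordism1965, Thm. 4.2 (PDF p. 23) and its proof; pattern of PDF p. 57] -/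
theorem Cobordism.IsNiceMorseFunction.exists_oneHandle_on_top (hn : 1 ≤ n) {c : Cobordism n M N} {g : c.W → ℝ}
    (hg : c.IsNiceMorseFunction g)
    (ξ : Cₛ^∞⟮𝓡∂ (n + 1); EuclideanSpace ℝ (Fin (n + 1)), (TangentSpace (𝓡∂ (n + 1)) : c.W → Type)⟯)
    (hξ : IsGradientLike (𝓡∂ (n + 1)) g ξ)
    (hidx : ∀ z ∈ criticalSet (𝓡∂ (n + 1)) g, morseIndex (𝓡∂ (n + 1)) g z ≤ 1)
    {q : c.W} (hq : q ∈ criticalSetOfIndex (𝓡∂ (n + 1)) g 1) :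
    ∃ (g₁ : c.W → ℝ) (c₀ : ℝ), c.IsMorseFunction g₁ ∧ IsGradientLike (𝓡∂ (n + 1)) g₁ ξ ∧
      criticalSet (𝓡∂ (n + 1)) g₁ = criticalSet (𝓡∂ (n + 1)) g ∧
      (∀ z ∈ criticalSet (𝓡∂ (n + 1)) g, morseIndex (𝓡∂ (n + 1)) g₁ z = morseIndex (𝓡∂ (n + 1)) g z) ∧
      plusLevel n 0 ≤ c₀ ∧ c₀ < g₁ q ∧ g₁ q < plusLevel n 1 ∧
      (∀ z ∈ criticalSet (𝓡∂ (n + 1)) g, z ≠ q → g₁ z < c₀) ∧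
      (∀ z, g z ∉ Ioo (plusLevel n 0) (plusLevel n 1) → g₁ z = g z) ∧
      (∀ z, g z ∈ Ioo (plusLevel n 0) (plusLevel n 1) → g₁ z ∈ Ioo (plusLevel n 0) (plusLevel n 1)) ∧
      (∃ d : ℝ, ∀ᶠ z in 𝓝 q, g₁ z = g z + d) :=
  hg.exists_oneHandle_on_top_above hn (niceLevel_lt_plusLevel n 0) (plusLevel_lt_niceLevel_succ n 0) ξ hξ hidx hq

end Literature.Topology.FourManifolds
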